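import Literature.NumberTheory.GaloisRepresentations.LocalClassFieldTheory
import Literature.NumberTheory.GaloisRepresentations.LubinTateNormGroup
import Literature.NumberTheory.GaloisRepresentations.WeilGroupFrobeniusPowers
import Literature.NumberTheory.GaloisRepresentations.LocalGaloisGroupFrobeniusProofs
import HarnessLib

/-!
# Uniqueness of the local Artin map (discharge of `IsLocalArtinMap.unique`)

Let `F` be a non-archimedean local field with Weil group `W_F = WeilGroup F`.  The named fact
`Literature.NumberTheory.GaloisRepresentations.IsLocalArtinMap.unique F` of
`LocalClassFieldTheory.lean` (Milne, *Class Field Theory* I Thm. 1.1, uniqueness half; Serre,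
*Local Fields* XIII §4 Thm. 1–2) says that two homomorphisms `a a' : W_F →* Fˣ` satisfying the
characterising clauses `IsLocalArtinMap F` (Deligne's normalisation `deg w = -1 ↦ uniformiser`,
clause `artin_frob`, and the reciprocity law at finite level `artin_mem_range_norm_iff`: for a
finite abelian `E ⊆ F̄`, `a w ∈ N_{E/F}(Eˣ) ↔ w|_E = 1`) are equal.  This file **proves** it:
`IsLocalArtinMap.unique_holds`.

## Proof

Only the clauses `artin_frob` and `artin_mem_range_norm_iff` are used, together with the PROVED
Lubin–Tate norm-group theorem `exists_abelian_norm_le_lubinTate_holds` (`LubinTateNormGroup.lean`;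
Cassels–Fröhlich VI §3.6 Cor., §3.8: for a uniformiser `x` and `n ≥ 1` a finite abelian
`E ⊆ F̄` with `x ∈ N(Eˣ) ⊆ ⟨x⟩ · U^{(n)}`).

1. *Degree `-1` elements* (`IsLocalArtinMap.apply_eq_of_deg_eq_neg_one`).  Let `deg w = -1`,
   `x = a w`, `y = a' w`; both are uniformisers.  If `x ≠ y`, the unit `u = x⁻¹ y ≠ 1` lies
   outside some `U^{(n)}`, `n ≥ 1` (`exists_not_mem_higherUnitGroup`: `⋂ₙ U^{(n)} = 1`).  For
   the Lubin–Tate field `E` of `x` at level `n`, clause (b) for `a` gives `w|_E = 1` (as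
   `x ∈ N(Eˣ)`), and then clause (b) for `a'` gives `y ∈ N(Eˣ) ⊆ ⟨x⟩ · U^{(n)}`; comparing
   valuations in `y = x^k t` forces `k = 1`, so `u = t ∈ U^{(n)}`
   (`inv_mul_mem_higherUnitGroup_of_mem_sup`) — a contradiction.
2. *Generation.*  `deg : W_F → ℤ` is a surjective homomorphism (`WeilGroup.deg_mul`,
   `WeilGroup.deg_zpow` of `WeilGroupFrobeniusPowers.lean`, `WeilGroup.deg_surjective`, fed with
   the discharged facts `IsFrobPow.mul_holds`, `IsFrobPow.unique_holds`, `exists_isFrobPow_holds`).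
   Pick `Φ` with `deg Φ = -1`; for any `w`, `w · Φ^{deg w + 1}` has degree `-1`, so step 1 applied
   to it and to `Φ` gives `a w = a' w`.

This is the argument of Milne I Thm. 1.1 ("`Fˣ` is generated by uniformisers, and for a
uniformiser `ϖ` the fields `F_{ϖ,n}` are abelian with `ϖ ∈ N(F_{ϖ,n}ˣ)`"), transported to
`W_F` (generated by its degree `-1` elements).  No topology of `W_F` or `Fˣ` is used.

## References

* J.-P. Serre, *Local Fields*, GTM 67 (1979), Ch. XIII §4 Thm. 1–2.  [SerreLocalFields1979]
* J.-P. Serre, *Local class field theory*, Ch. VI of Cassels–Fröhlich (1967), §3.6 Cor., §3.8.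
  [CasselsFrohlichANT1967]

## Not here

Existence of a map with the five clauses (`exists_isLocalArtinMap`) is a separate named fact,
discharged elsewhere.  Nothing in this file duplicates a Mathlib declaration (Mathlib has no
local class field theory at this pin).
-/

noncomputable section

open ValuativeRel Valuation

namespace Literature.NumberTheory.GaloisRepresentations

section Valuations

variable {F : Type*} [Field F] [ValuativeRel F] [TopologicalSpace F] [IsNonarchimedeanLocalField F]

/-- **`⋂ₙ U^{(n)} = 1`**: a unit `u ≠ 1` of `F` lies outside some higher unit group `U^{(n)}`,
`n ≥ 1` (take `n` with `v(π)^n < v(u - 1)`, the valuation being discrete).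
Ref: Serre, *Local Fields*, Ch. IV §2. [folklore] -/
theorem exists_not_mem_higherUnitGroup {u : Fˣ} (hu : u ≠ 1) :
    ∃ n : ℕ, 0 < n ∧ u ∉ higherUnitGroup F n := by
  have h0 : (u : F) - 1 ≠ 0 := sub_ne_zero.mpr fun h => hu (Units.val_eq_one.mp h)
  obtain ⟨k, hk⟩ := exists_valuation_eq_unifValue_zpow F h0
  refine ⟨(max k 0).toNat + 1, Nat.succ_pos _, fun hmem => ?_⟩
  have h := (mem_higherUnitGroup_iff.mp hmem).2
  rw [hk, ← zpow_natCast,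
    zpow_le_zpow_iff_right_of_lt_one₀ (unifValue_pos F) (unifValue_lt_one F)] at h
  omega

/-- **Two uniformisers congruent modulo `⟨x⟩ · U^{(n)}` differ by an element of `U^{(n)}`**: if
`x`, `y` are uniformisers and `y ∈ ⟨x⟩ · U^{(n)}`, then `x⁻¹ y ∈ U^{(n)}` (write `y = x^k t`
with `t ∈ U^{(n)}` and compare valuations: `v(π) = v(π)^k`, so `k = 1`). [folklore] -/
theorem inv_mul_mem_higherUnitGroup_of_mem_sup {x y : Fˣ} (hx : (valuation F).IsUniformizer (x : F))
    (hy : (valuation F).IsUniformizer (y : F)) {n : ℕ}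
    (hmem : y ∈ Subgroup.zpowers x ⊔ higherUnitGroup F n) : x⁻¹ * y ∈ higherUnitGroup F n := by
  obtain ⟨p, hp, t, ht, hpt⟩ := Subgroup.mem_sup.mp hmem
  obtain ⟨k, rfl⟩ := Subgroup.mem_zpowers_iff.mp hp
  have hxv : valuation F (x : F) = unifValue F := hx
  have hyv : valuation F (y : F) = unifValue F := hy
  have hval : valuation F ((x ^ k * t : Fˣ) : F) = unifValue F ^ k := by
    push_cast
    rw [Valuation.map_mul, map_zpow₀, hxv, (mem_higherUnitGroup_iff.mp ht).1, mul_one]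
  rw [hpt, hyv] at hval
  have hk : (1 : ℤ) = k :=
    (zpow_right_strictAnti₀ (unifValue_pos F) (unifValue_lt_one F)).injective
      (by rw [zpow_one]; exact hval)
  subst hk
  rw [zpow_one] at hpt
  rw [← hpt, inv_mul_cancel_left]
  exact ht

end Valuations

section Unique

variable {F : Type*} [Field F] [ValuativeRel F] [TopologicalSpace F] [IsNonarchimedeanLocalField F]

/-- **Two local Artin maps agree on the elements of degree `-1`.**  For `deg w = -1` both
`a w` and `a' w` are uniformisers (`artin_frob`); if they differed, `u = (a w)⁻¹ (a' w) ∉ U^{(n)}`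
for some `n ≥ 1`, and for the Lubin–Tate field `E` of the uniformiser `a w` at level `n`
(`exists_abelian_norm_le_lubinTate_holds`: `a w ∈ N(Eˣ) ⊆ ⟨a w⟩ · U^{(n)}`) the reciprocity law at
finite level for `a` gives `w|_E = 1`, whence for `a'` it gives `a' w ∈ N(Eˣ)`, so
`u ∈ U^{(n)}` — a contradiction.  This is the uniqueness argument of Milne, *Class Field Theory*
I Thm. 1.1; Serre, *Local Fields* XIII §4.
[cite: SerreLocalFields1979, Ch. XIII §4 Thm. 1–2] -/
theorem IsLocalArtinMap.apply_eq_of_deg_eq_neg_one {a a' : WeilGroup F →* Fˣ}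
    (ha : IsLocalArtinMap F a) (ha' : IsLocalArtinMap F a') {w : WeilGroup F}
    (hw : WeilGroup.deg w = -1) : a w = a' w := by
  by_contra hne
  have hu : (a w)⁻¹ * a' w ≠ 1 := fun h => hne (inv_mul_eq_one.mp h)
  obtain ⟨n, hn, hnot⟩ := exists_not_mem_higherUnitGroup hu
  obtain ⟨E, hfd, hab, -, hxE, hle⟩ :=
    exists_abelian_norm_le_lubinTate_holds F (a w) (ha.artin_frob w hw) n hn
  haveI := hfd
  haveI := hab
  have hfix : WeilGroup.toAbsGalois F w ∈ E.fixingSubgroup :=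
    (ha.artin_mem_range_norm_iff E w).mp hxE
  have hyE : a' w ∈ (Units.map (Algebra.norm F : E →* F)).range :=
    (ha'.artin_mem_range_norm_iff E w).mpr hfix
  exact hnot (inv_mul_mem_higherUnitGroup_of_mem_sup (ha.artin_frob w hw) (ha'.artin_frob w hw)
    (hle hyE))

variable (F) in
/-- **Uniqueness of the local Artin map** (discharge of the named fact `IsLocalArtinMap.unique F`;
Milne, *Class Field Theory* I Thm. 1.1, "there is a unique homomorphism … (a) … (b) …"; Serre,
*Local Fields* XIII §4 Thm. 1–2): two homomorphisms `W_F →* Fˣ` with the characterising clauses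
`IsLocalArtinMap F` are equal.  By `IsLocalArtinMap.apply_eq_of_deg_eq_neg_one` they agree on
every element of degree `-1`, and these generate `W_F`: with `deg Φ = -1`
(`WeilGroup.deg_surjective`), `w = (w Φ^{deg w + 1}) · (Φ^{deg w + 1})⁻¹` where
`deg (w Φ^{deg w + 1}) = -1`. [cite: SerreLocalFields1979, Ch. XIII §4 Thm. 1–2] -/
theorem IsLocalArtinMap.unique_holds : IsLocalArtinMap.unique F := by
  intro a a' ha ha'
  obtain ⟨Φ, hΦ⟩ := WeilGroup.deg_surjective IsFrobPow.mul_holds IsFrobPow.unique_holds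
    (exists_isFrobPow_holds F) (-1)
  have hΦeq : a Φ = a' Φ := ha.apply_eq_of_deg_eq_neg_one ha' hΦ
  refine MonoidHom.ext fun w => ?_
  have hdeg : WeilGroup.deg (w * Φ ^ (WeilGroup.deg w + 1)) = -1 := by
    rw [WeilGroup.deg_mul IsFrobPow.mul_holds IsFrobPow.unique_holds, WeilGroup.deg_zpow, hΦ]
    ring
  have key : a (w * Φ ^ (WeilGroup.deg w + 1)) = a' (w * Φ ^ (WeilGroup.deg w + 1)) :=
    ha.apply_eq_of_deg_eq_neg_one ha' hdeg
  rw [map_mul, map_mul, map_zpow, map_zpow, hΦeq] at key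
  exact mul_right_cancel key

end Unique

end Literature.NumberTheory.GaloisRepresentations
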